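import Summits.ResolutionOfSingularities.ResolutionOfSingularities.Theorems.RadicialJungCleanModelsSufficeChartsPoint
import Summits.ResolutionOfSingularities.ResolutionOfSingularities.Theorems.RadicialJungCleanModelsSufficeChartsStalkIso

/-!
# Route `RadicialJung`, crux `CleanModelsSuffice`, line `Sketch`: the toroidal Kato chart as
# sections of `V^L`, and its log regularity at every point

Helper for the registered stub `stub_charts` of the skeleton of
`Summit.ResolutionOfSingularities.ResolutionOfSingularities.Theses.RadicialJung.CleanModelsSuffice`
(stmt-ResolutionOfSingularities-15883). At a toroidal point `v` of the adapted model choose an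
affine open `U' v ∋ v` inside `U v`; the Kummer chart `Φ v : P_{a'} → L`,
`c ↦ y'^{c₀} ∏_{i≠0} uC_i^{c_i}`, has values integral over `Γ(V, U' v)` (their `p`-th powers are
monomials in the charged sections), hence LIFTS to a chart `φ v : P_{a'} → Γ(V^L, ι⁻¹ U' v)` by
sections of the normalisation (`liftToSections` of `…ChartsField`). Through the isomorphism
`𝒪_{V^L,x} ≃ integralClosure 𝒪_{V,w} L` of `…ChartsStalkIso` (`w = ι x`, available because these
integral closures are local, `…ChartsPoint`) the germ at `x` of `φ v c` is the value at `c` of the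
Kummer chart `kci v w` read in `𝒪_{V,w}`; so Kato's condition for `φ v` at `x` is that of
`kci v w`, which holds in Case A (`…ChartsPoint.caseA`), while in Case B the chart is by units at
`x` and `𝒪_{V^L,x}` is regular (`w` is then of regular type). Hence the toroidal chart is log
regular at every point of its domain (`isLogRegularLocal_φ`); over regular-type points the
trivial chart is (`isLogRegularLocal_one`).
-/

noncomputable section

set_option linter.dupNamespace false -- mandated namespace of this single-conjunct summit

open CategoryTheory AlgebraicGeometry TopologicalSpace
open Literature.AlgebraicGeometry.Resolution

namespace Summit.ResolutionOfSingularities.ResolutionOfSingularities.Theorems.RadicialJung.CleanModelsSuffice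

attribute [local instance] stalkAlgebra isScalarTower_stalkAlgebra sectionsAlgebra

namespace AdaptedData

variable {p : ℕ} {V : Scheme.{0}} [IsIntegral V] {L : Type} [Field L] [Algebra V.functionField L]
variable (D : AdaptedData p V L)
/-! ## An affine neighbourhood inside `U v` -/

/-- There is an affine open `U' ∋ v` inside `U v`. [folklore] -/
theorem exists_affine (v : V) : ∃ U' : V.Opens, IsAffineOpen U' ∧ v ∈ U' ∧ U' ≤ D.U v := by
  obtain ⟨_, ⟨U', hU', rfl⟩, hv, hle⟩ :=
    V.isBasis_affineOpens.exists_subset_of_mem_open (D.hU v) (D.U v).isOpen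
  exact ⟨U', hU', hv, hle⟩

/-- The chart domain `U' v`: an affine open neighbourhood of `v` inside `U v`. [folklore] -/
def U' (v : V) : V.Opens :=
  (D.exists_affine v).choose

/-- `U' v` is affine. [folklore] -/
theorem isAffineOpen_U' (v : V) : IsAffineOpen (D.U' v) :=
  (D.exists_affine v).choose_spec.1

/-- `v ∈ U' v`. [folklore] -/
theorem mem_U' (v : V) : v ∈ D.U' v :=
  (D.exists_affine v).choose_spec.2.1

/-- `U' v ⊆ U v`. [folklore] -/
theorem U'_le (v : V) : D.U' v ≤ D.U v :=
  (D.exists_affine v).choose_spec.2.2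

/-- `U' v` is non-empty. [folklore] -/
instance nonempty_U' (v : V) : Nonempty (D.U' v) :=
  ⟨⟨v, D.mem_U' v⟩⟩

variable (hNorm : ∀ {O K L : Type} [CommRing O] [IsDomain O] [Field K] [Algebra O K]
  [IsFractionRing O K] [Field L] [Algebra K L] [Algebra O L] [IsScalarTower O K L]
  (p : ℕ) (_ : p.Prime) [CharP K p] (_ : Module.finrank K L = p) (m : ℕ)
  (t : Fin (m + 1) → O) (_ : ∀ i, t i ≠ 0) (a : Fin (m + 1) → ℕ) (_ : ∀ i, ¬ p ∣ a i)
  (y : L) (_ : y ∉ Set.range (algebraMap K L))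
  (_ : y ^ p = algebraMap O L (∏ i, t i ^ a i)),
  ∃ (y' : L) (a' : Fin (m + 1) → ℕ) (c : ℕ), y' ∉ Set.range (algebraMap K L) ∧
    a' 0 = 1 ∧ (∀ i, 1 ≤ a' i ∧ a' i < p) ∧ ¬ p ∣ c ∧ (∀ i, a' i ≡ c * a i [MOD p]) ∧
    y' ^ p = algebraMap O L (∏ i, t i ^ a' i))
variable (hp : p.Prime) [CharP V.functionField p] (hdeg : Module.finrank V.functionField L = p)

/-! ## The chart values and their lift to sections of `V^L` -/

/-- **The Kummer chart of the toroidal point `v` with values in `L`**: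
`c ↦ y'^{c₀} ∏_{i≠0} uC_i^{c_i}`. [folklore] -/
def Φ (v : V) (hm : 0 < D.m v) : Multiplicative (kummerMonoid p (D.a' hNorm hp hdeg v hm)) →* L :=
  kummerChart p (D.a' hNorm hp hdeg v hm) (D.y' hNorm hp hdeg v hm) (D.uC v hm)
    (D.y'_ne_zero hNorm hp hdeg v hm) (D.uC_ne_zero v hm hp)

omit [CharP V.functionField p] in
/-- The `uC_i` are the images of the charged sections restricted to `U' v`. [folklore] -/
theorem uC_eq_algebraMap_map (v : V) (hm : 0 < D.m v) (i : Fin (D.m v - 1 + 1)) :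
    D.uC v hm i = algebraMap Γ(V, D.U' v) L
      (V.presheaf.map (homOfLE (D.U'_le v)).op (D.sC v hm i)) := by
  change _ = algebraMap V.functionField L
    (V.germToFunctionField (D.U' v) (V.presheaf.map (homOfLE (D.U'_le v)).op (D.sC v hm i)))
  rw [uC]
  congr 1
  exact (TopCat.Presheaf.germ_res_apply V.presheaf _ _ _ _).symm

/-- The chart values are integral over `Γ(V, U' v)`. [folklore] -/
theorem isIntegral_Φ (v : V) (hm : 0 < D.m v)
    (c : Multiplicative (kummerMonoid p (D.a' hNorm hp hdeg v hm))) :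
    IsIntegral Γ(V, D.U' v) (D.Φ hNorm hp hdeg v hm c) := by
  refine IsIntegral.of_pow hp.pos ?_
  rw [Φ, kummerChart_apply, kummerChartFun_pow_of_mem p _ _ _ (D.uC_ne_zero v hm hp)
    (D.normalized_spec hNorm hp hdeg v hm).2.2.2.2.2 (Multiplicative.toAdd c).2]
  have h : ∏ i, D.uC v hm i ^ (kummerWeight p (D.a' hNorm hp hdeg v hm)
      ((Multiplicative.toAdd c : kummerMonoid p (D.a' hNorm hp hdeg v hm)) :
        Fin (D.m v - 1 + 1) → ℤ) i).toNat =
      algebraMap Γ(V, D.U' v) L (∏ i, (V.presheaf.map (homOfLE (D.U'_le v)).op (D.sC v hm i)) ^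
        (kummerWeight p (D.a' hNorm hp hdeg v hm)
          ((Multiplicative.toAdd c : kummerMonoid p (D.a' hNorm hp hdeg v hm)) :
            Fin (D.m v - 1 + 1) → ℤ) i).toNat) := by
    rw [map_prod]
    refine Finset.prod_congr rfl fun i _ => ?_
    rw [map_pow, ← D.uC_eq_algebraMap_map v hm i]
  rw [h]
  exact isIntegral_algebraMap

/-- **The toroidal Kato chart** `φ v : P_{a'} → Γ(V^L, ι⁻¹ U' v)` by sections of the
normalisation, lifting `Φ v`. [folklore] -/
def φ (v : V) (hm : 0 < D.m v) : Multiplicative (kummerMonoid p (D.a' hNorm hp hdeg v hm)) →*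
    Γ(normalizationIn V L, normalizationInι V L ⁻¹ᵁ D.U' v) :=
  liftToSections (D.isAffineOpen_U' v) (D.Φ hNorm hp hdeg v hm) (D.isIntegral_Φ hNorm hp hdeg v hm)

/-- **The germ of `φ v c` at `x` has value `Φ v c` in `L`.** [folklore] -/
theorem stalkToField_germ_φ (v : V) (hm : 0 < D.m v) (x : normalizationIn V L)
    (hx : x ∈ normalizationInι V L ⁻¹ᵁ D.U' v)
    (c : Multiplicative (kummerMonoid p (D.a' hNorm hp hdeg v hm))) :
    stalkToField V L x ((normalizationIn V L).presheaf.germ (normalizationInι V L ⁻¹ᵁ D.U' v) x hx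
      (D.φ hNorm hp hdeg v hm c)) = D.Φ hNorm hp hdeg v hm c := by
  rw [stalkToField_germ]
  exact sectionToField_liftToSections (D.isAffineOpen_U' v) _ _ c

/-! ## Through the stalk isomorphism, the germs of the chart are the Kummer chart at `w` -/

section Stalk

variable (hVreg : Scheme.IsRegular V)
variable (hK4 : ∀ (R : Type) [CommRing R] [IsNoetherianRing R] [IsLocalRing R] (n : ℕ)
  (P : AddSubmonoid (Fin n → ℤ)) (φ : Multiplicative P →* R),
  P.FG → P.NSMulSaturated → Submodule.span ℤ (P : Set (Fin n → ℤ)) = ⊤ →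
  LogChart.IsLogRegularLocal P φ → IsDomain R ∧ IsIntegrallyClosed R)
variable (hStruct : ∀ {A K L : Type} [CommRing A] [IsRegularLocalRing A] [Field K]
  [Algebra A K] [IsFractionRing A K] [Field L] [Algebra K L] [Algebra A L] [IsScalarTower A K L]
  (p : ℕ) (_ : p.Prime) [CharP K p] (_ : Module.finrank K L = p) (m : ℕ)
  (t : Fin (m + 1) → A) (_ : ∀ i, t i ≠ 0) (a : Fin (m + 1) → ℕ) (_ : a 0 = 1)
  (_ : ∀ i, 1 ≤ a i ∧ a i < p) (y : L) (_ : y ∉ Set.range (algebraMap K L))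
  (_ : y ^ p = algebraMap A L (∏ i, t i ^ a i)) (z : Fin p → L)
  (_ : ∀ j, z j = y ^ (j : ℕ) / algebraMap A L (∏ i, t i ^ ((j : ℕ) * a i / p))),
  Subalgebra.toSubmodule (Algebra.adjoin A (Set.range z)) = Submodule.span A (Set.range z) ∧
  LinearIndependent A z ∧ Module.Finite A (Algebra.adjoin A (Set.range z)) ∧
  IsLocalRing (Algebra.adjoin A (Set.range z)) ∧
  IsFractionRing (Algebra.adjoin A (Set.range z)) L)
variable (hLogReg : ∀ {A K L : Type} [CommRing A] [IsRegularLocalRing A] [Field K]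
  [Algebra A K] [IsFractionRing A K] [Field L] [Algebra K L] [Algebra A L] [IsScalarTower A K L]
  (p : ℕ) (_ : p.Prime) [CharP K p] (_ : Module.finrank K L = p) (m : ℕ)
  (t : Fin (m + 1) → A) (_ : ∀ i, t i ≠ 0) (a : Fin (m + 1) → ℕ) (_ : a 0 = 1)
  (_ : ∀ i, 1 ≤ a i ∧ a i < p) (y : L) (_ : y ∉ Set.range (algebraMap K L))
  (_ : y ^ p = algebraMap A L (∏ i, t i ^ a i))
  (S : Finset (Fin (m + 1))) (_ : ∀ i, i ∈ S ↔ t i ∈ IsLocalRing.maximalIdeal A)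
  (_ : S.Nonempty)
  (_ : IsRegularLocalRing (A ⧸ Ideal.span (t '' (S : Set (Fin (m + 1))))))
  (_ : ringKrullDim (A ⧸ Ideal.span (t '' (S : Set (Fin (m + 1))))) + (S.card : WithBot ℕ∞) =
    ringKrullDim A)
  (P : AddSubmonoid (Fin (m + 1) → ℤ))
  (_ : ∀ c : Fin (m + 1) → ℤ, c ∈ P ↔
    0 ≤ c 0 ∧ ∀ i : Fin (m + 1), i ≠ 0 → 0 ≤ (a i : ℤ) * c 0 + (p : ℤ) * c i)
  (φ : Multiplicative P →*
    Algebra.adjoin A (Set.range fun j : Fin p =>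
      y ^ (j : ℕ) / algebraMap A L (∏ i, t i ^ ((j : ℕ) * a i / p))))
  (_ : ∀ c : P, ((φ (Multiplicative.ofAdd c) : Algebra.adjoin A (Set.range fun j : Fin p =>
      y ^ (j : ℕ) / algebraMap A L (∏ i, t i ^ ((j : ℕ) * a i / p)))) : L) =
    y ^ ((c : Fin (m + 1) → ℤ) 0) *
      ∏ i ∈ Finset.univ.erase 0, algebraMap A L (t i) ^ ((c : Fin (m + 1) → ℤ) i)),
  LogChart.IsLogRegularLocal P φ)

include D hNorm hp hdeg hVreg hK4 hStruct hLogReg in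
/-- **The stalk isomorphism** `𝒪_{V^L,x} ≃ integralClosure 𝒪_{V,ιx} L` compatible with values in
`L` (it exists because the integral closure is local, `isLocalRing_integralClosure`).
[folklore] -/
theorem exists_stalkIso (x : normalizationIn V L) :
    ∃ e : (normalizationIn V L).presheaf.stalk x ≃+*
        integralClosure (V.presheaf.stalk (normalizationInι V L x)) L,
      ∀ z, ((e z : integralClosure (V.presheaf.stalk (normalizationInι V L x)) L) : L) =
        stalkToField V L x z := by
  haveI := D.isLocalRing_integralClosure hNorm hp hdeg hVreg hK4 hStruct hLogReg
    (normalizationInι V L x)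
  exact exists_ringEquiv_stalk_integralClosure V L x

/-- **Through the stalk isomorphism the germ of `φ v c` is `kci v (ι x) c`.** [folklore] -/
theorem stalkIso_germ_φ (v : V) (hm : 0 < D.m v) (x : normalizationIn V L)
    (hx : x ∈ normalizationInι V L ⁻¹ᵁ D.U' v)
    (e : (normalizationIn V L).presheaf.stalk x ≃+*
      integralClosure (V.presheaf.stalk (normalizationInι V L x)) L)
    (he : ∀ z, ((e z : integralClosure (V.presheaf.stalk (normalizationInι V L x)) L) : L) =
      stalkToField V L x z)
    (c : Multiplicative (kummerMonoid p (D.a' hNorm hp hdeg v hm))) :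
    e ((normalizationIn V L).presheaf.germ (normalizationInι V L ⁻¹ᵁ D.U' v) x hx
      (D.φ hNorm hp hdeg v hm c)) = D.kci hNorm hp hdeg v hm (normalizationInι V L x) (D.U'_le v hx) c := by
  apply Subtype.ext
  rw [he, D.stalkToField_germ_φ, coe_kci]
  rfl

/-- The same, as an equality of monoid homomorphisms `P_{a'} → integralClosure 𝒪_{V,ιx} L`.
[folklore] -/
theorem comp_germ_φ_eq_kci (v : V) (hm : 0 < D.m v) (x : normalizationIn V L)
    (hx : x ∈ normalizationInι V L ⁻¹ᵁ D.U' v)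
    (e : (normalizationIn V L).presheaf.stalk x ≃+*
      integralClosure (V.presheaf.stalk (normalizationInι V L x)) L)
    (he : ∀ z, ((e z : integralClosure (V.presheaf.stalk (normalizationInι V L x)) L) : L) =
      stalkToField V L x z) :
    e.toMonoidHom.comp (((normalizationIn V L).presheaf.germ (normalizationInι V L ⁻¹ᵁ D.U' v) x
      hx).hom.toMonoidHom.comp (D.φ hNorm hp hdeg v hm)) =
      D.kci hNorm hp hdeg v hm (normalizationInι V L x) (D.U'_le v hx) :=
  MonoidHom.ext fun c => D.stalkIso_germ_φ hNorm hp hdeg v hm x hx e he c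

include hVreg hK4 hStruct hLogReg in
/-- **The toroidal Kato chart is log regular at every point of its domain** (Case A: transport
the log regularity of `kci v (ι x)` along the stalk isomorphism; Case B: the chart is by units
at `x` and `𝒪_{V^L,x}` is regular). [folklore] -/
theorem isLogRegularLocal_φ (v : V) (hm : 0 < D.m v) (x : normalizationIn V L)
    (hx : x ∈ normalizationInι V L ⁻¹ᵁ D.U' v) :
    LogChart.IsLogRegularLocal (kummerMonoid p (D.a' hNorm hp hdeg v hm))
      (((normalizationIn V L).presheaf.germ (normalizationInι V L ⁻¹ᵁ D.U' v) x
        hx).hom.toMonoidHom.comp (D.φ hNorm hp hdeg v hm)) := by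
  obtain ⟨e, he⟩ := D.exists_stalkIso hNorm hp hdeg hVreg hK4 hStruct hLogReg x
  have hcomp := D.comp_germ_φ_eq_kci hNorm hp hdeg v hm x hx e he
  by_cases hA : ∃ i, D.tw v hm (normalizationInι V L x) (D.U'_le v hx) i ∈
      IsLocalRing.maximalIdeal (V.presheaf.stalk (normalizationInι V L x))
  · have h := (D.caseA hNorm hp hdeg hVreg hK4 hStruct hLogReg v hm _ (D.U'_le v hx) hA).2
    rw [← hcomp] at h
    exact (LogChart.isLogRegularLocal_comp_equiv _ _ e).mp h
  · push Not at hA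
    have hunit : ∀ c : kummerMonoid p (D.a' hNorm hp hdeg v hm),
        IsUnit ((((normalizationIn V L).presheaf.germ (normalizationInι V L ⁻¹ᵁ D.U' v) x
          hx).hom.toMonoidHom.comp (D.φ hNorm hp hdeg v hm)) (Multiplicative.ofAdd c)) := by
      intro c
      have h1 := D.isUnit_kci hNorm hp hdeg v hm _ (D.U'_le v hx) hA (Multiplicative.ofAdd c)
      rw [← D.stalkIso_germ_φ hNorm hp hdeg v hm x hx e he] at h1
      exact (isUnit_map_iff e _).mp h1
    rw [LogChart.isLogRegularLocal_iff_of_forall_isUnit _ (span_kummerMonoid_eq_top p _) _ hunit]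
    exact D.isRegularLocalRing_stalk_of_m_eq_zero hp hdeg hVreg x
      (D.m_eq_zero_of_forall_not_mem v hm _ (D.U'_le v hx) hA)

end Stalk

/-! ## The trivial chart over regular-type points -/

include hp hdeg in
/-- **Over a regular-type chart the trivial chart is log regular**: for `m v = 0` every point of
`V^L` over `U v` has a regular local ring. [folklore] -/
theorem isLogRegularLocal_one (hVreg : Scheme.IsRegular V) (v : V) (hv : D.m v = 0)
    (x : normalizationIn V L) (hx : normalizationInι V L x ∈ D.U v)
    (W : (normalizationIn V L).Opens) (hxW : x ∈ W) :
    LogChart.IsLogRegularLocal (⊤ : AddSubmonoid (Fin 0 → ℤ))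
      (((normalizationIn V L).presheaf.germ W x hxW).hom.toMonoidHom.comp
        (1 : Multiplicative (⊤ : AddSubmonoid (Fin 0 → ℤ)) →* Γ(normalizationIn V L, W))) :=
  (LogChart.isLogRegularLocal_zero_iff _ _).mpr
    (D.isRegularLocalRing_stalk_of_m_eq_zero hp hdeg hVreg x (D.m_eq_zero_of_mem v hv _ hx))

end AdaptedData

/-- `v` lies in its chart domain `U' v` (explicit-binder form, the registered interface of this
helper file). [folklore] -/
theorem adaptedData_mem_U' {p : ℕ} {V : Scheme.{0}} [IsIntegral V] {L : Type} [Field L]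
    [Algebra V.functionField L] (D : AdaptedData p V L) (v : V) : v ∈ D.U' v :=
  D.mem_U' v

end Summit.ResolutionOfSingularities.ResolutionOfSingularities.Theorems.RadicialJung.CleanModelsSuffice

end
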